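import Summits.NavierStokesRegularity.NavierStokesRegularity.Theorems.EulerZoomLiouvillePowerGaugeEulerLiouvillePowerClockRigidityNegData
import Summits.NavierStokesRegularity.NavierStokesRegularity.Theorems.EulerZoomLiouvillePowerGaugeEulerLiouvillePowerClockRigidity

/-!
# Crux `EulerZoomLiouville.PowerGaugeEulerLiouville` (stmt-NavierStokesRegularity-19832), line `logtime-breathers` (T4):
# classical power clocks with NEGATIVE rate `γ < 0` about any `T₀ ≥ 0` are trivial, u-only

Width seat `ns-ezl-w4` (power-clock rigidity, file VII; sequel of `…PowerClockRigidityNegData`, `…PowerClockRigidity`).  Scale-ODE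
rigidity `ClassicalProfile.eq_zero_of_locData_of_scaleODE` with `(α, β) = (1−γ, γ)`, `κ = 2/γ − 5 < −5` (so `κ + 1 − 2ρ < 0` for every
`ρ > 0`) and the `γ ≤ 0` data bricks:

* `exists_locData_neg` — large-scale class data with one constant for `γ ≤ 0`;
* `ae_eq_zero_of_gauge_of_classicalNegPowerClock` — crux hypotheses (`0 < ρ ≤ ½`) + `(u, p)` classical + `u(τ, y) =
  (T₀−τ)^{γ−1} W((T₀−τ)^{−γ} y)` (`τ < 0`, `T₀ ≥ 0`, `γ < 0`) ⇒ `u = 0` a.e.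

With `…PowerClockRigidity` (`1/(2+ρ) < γ ≤ 2/3`), `…PowerClockRigiditySlow` (`0 < γ < 2/5`) and `…PastFastClock` (`γ > ½ − ρ/5`) the
classical power clocks about `T₀ ≥ 0` left open are `γ = 0` and `2/5 ≤ γ ≤ 1/(2+ρ)` (`T₀ > 0`; for `T₀ = 0` only `γ = 1/(2+ρ)`).

WHAT THIS IS NOT: not NS regularity, not the crux — a sub-stratum of T4 on the MODEL lattice; `--supports` stmt-19832. [folklore]
-/

noncomputable section

set_option linter.dupNamespace false

open MeasureTheory Set Filter Topology Metric Function TopologicalSpace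
open scoped ENNReal NNReal RealInnerProductSpace ContDiff

namespace Summit.NavierStokesRegularity.NavierStokesRegularity.Theorems.PowerGaugeEulerLiouville

open Literature.Analysis Literature.Analysis.FunctionSpaces Literature.Analysis.FluidPDE

namespace PowerClockRigidity

variable {u : ℝ → EuclideanSpace ℝ (Fin 3) → EuclideanSpace ℝ (Fin 3)} {p : ℝ → EuclideanSpace ℝ (Fin 3) → ℝ}
  {H : ℝ → EuclideanSpace ℝ (Fin 3) → EuclideanSpace ℝ (Fin 3) →L[ℝ] EuclideanSpace ℝ (Fin 3)}
  {T₀ g : ℝ} {W : EuclideanSpace ℝ (Fin 3) → EuclideanSpace ℝ (Fin 3)}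

/-- **Large-scale class data of a classical power clock with `γ ≤ 0` about `T₀ ≥ 0`, one constant** (twin of `exists_locData`). [folklore] -/
theorem exists_locData_neg {ρ : ℝ} (hρ : 0 < ρ) (hρh : ρ ≤ 1 / 2) {c₀ : ℝ≥0}
    (hH : HasWeakSpatialGradientOn (slab (EuclideanSpace ℝ (Fin 3)) (Iio 0) isOpen_Iio) u H)
    (hgauge : ∀ a : ℝ, 0 < a →
      ENNReal.ofReal (a ^ (2 * ρ)) * cknA a (0 : ℝ × EuclideanSpace ℝ (Fin 3)) u +
          ENNReal.ofReal (a ^ ρ) * cknE a (0 : ℝ × EuclideanSpace ℝ (Fin 3)) H +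
        ENNReal.ofReal (a ^ (2 * ρ)) * cknD a (0 : ℝ × EuclideanSpace ℝ (Fin 3)) p ≤ (c₀ : ℝ≥0∞))
    (hcl : IsClassicalEulerSolutionOn (Iio 0) 0 u p) (hT₀ : 0 ≤ T₀) (hg0 : g ≤ 0)
    (hW : ∀ τ : ℝ, τ < 0 → ∀ y, u τ y = (T₀ - τ) ^ (g - 1) • W ((T₀ - τ) ^ (-g) • y)) :
    ∃ (P : EuclideanSpace ℝ (Fin 3) → ℝ) (c' : ℝ≥0), ContDiff ℝ 1 P ∧
      (∀ z, (1 - g) • W z + g • fderiv ℝ W z z + fderiv ℝ W z (W z) + gradient P z = 0) ∧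
      (∀ L : ℝ, 1 ≤ L → ∫⁻ y in ball (0 : EuclideanSpace ℝ (Fin 3)) L, ‖W y‖ₑ ^ 2 ≤
        (c' : ℝ≥0∞) * ENNReal.ofReal (L ^ (1 - 2 * ρ))) ∧
      (∀ L : ℝ, 1 ≤ L →
        ∫⁻ y in ball (0 : EuclideanSpace ℝ (Fin 3)) L, ENNReal.ofReal (frobeniusNormSq (fderiv ℝ W y)) ≤
          ENNReal.ofReal (L ^ (1 - ρ)) * (ENNReal.ofReal ((1 - ρ) / (2 + ρ)) * (c' : ℝ≥0∞))) ∧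
      (∀ L : ℝ, 1 ≤ L →
        ∫⁻ y in ball (0 : EuclideanSpace ℝ (Fin 3)) L, ‖P y‖ₑ ^ (3 / 2 : ℝ) ≤
          ENNReal.ofReal (L ^ (2 - 2 * ρ)) * (ENNReal.ofReal ((2 - 2 * ρ) / (2 + ρ)) * (c' : ℝ≥0∞))) := by
  -- adapted from `exists_locData`
  have hρ1 : ρ < 1 := by linarith
  have h2ρ : (0 : ℝ) < 2 + ρ := by linarith
  have hA : ∀ a : ℝ, 0 < a → ENNReal.ofReal (a ^ (2 * ρ)) *
      cknA a (0 : ℝ × EuclideanSpace ℝ (Fin 3)) u ≤ (c₀ : ℝ≥0∞) :=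
    fun a ha => le_trans (le_trans le_self_add le_self_add) (hgauge a ha)
  have hE : ∀ a : ℝ, 0 < a → ENNReal.ofReal (a ^ ρ) *
      cknE a (0 : ℝ × EuclideanSpace ℝ (Fin 3)) H ≤ (c₀ : ℝ≥0∞) :=
    fun a ha => le_trans (le_trans le_add_self le_self_add) (hgauge a ha)
  have hD : ∀ a : ℝ, 0 < a → ENNReal.ofReal (a ^ (2 * ρ)) *
      cknD a (0 : ℝ × EuclideanSpace ℝ (Fin 3)) p ≤ (c₀ : ℝ≥0∞) :=
    fun a ha => le_trans le_add_self (hgauge a ha)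
  set P : EuclideanSpace ℝ (Fin 3) → ℝ := fun z =>
    ∫ τ in Ioo (-2 : ℝ) (-1), (((T₀ - τ) ^ (g - 1)) ^ 2)⁻¹ * p τ ((T₀ - τ) ^ g • z) with hP
  obtain ⟨hPc, heqP⟩ := profile_equation_avg (g := g) hcl hT₀ hW
  have hWc : Continuous W := (PowerClock.contDiff_profile hcl hT₀ hW).continuous
  obtain ⟨CA, hCAt, hA0⟩ := PowerClock.profile_growth hρ hρh hT₀ hA hW hWc
  have hA1 : ∀ L : ℝ, 1 ≤ L → ∫⁻ y in ball (0 : EuclideanSpace ℝ (Fin 3)) L, ‖W y‖ₑ ^ 2 ≤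
      CA * ENNReal.ofReal (L ^ (1 - 2 * ρ)) :=
    fun L hL => hA0 L (lt_of_lt_of_le one_pos hL)
  have hHm : AEStronglyMeasurable (uncurry H)
      (volume.restrict (Iio (0 : ℝ) ×ˢ (univ : Set (EuclideanSpace ℝ (Fin 3))))) := by
    have := hH.locallyIntegrableOn_grad.aestronglyMeasurable
    simpa [slab] using this
  have hHV := ae_slice_gradient_eq hH hcl hT₀ hW
  set CE : ℝ≥0∞ := ENNReal.ofReal ((T₀ + 2) ^ (2 - 3 * g)) * (c₀ : ℝ≥0∞) with hCE
  have hE2 : ∀ L : ℝ, 2 ≤ L →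
      ∫⁻ y in ball (0 : EuclideanSpace ℝ (Fin 3)) L, ENNReal.ofReal (frobeniusNormSq (fderiv ℝ W y)) ≤
        CE * ENNReal.ofReal (L ^ (1 - ρ)) :=
    profile_gradient_growth_of_gaugeE_nonpos hT₀ hg0 hHm hHV hE
  set CD : ℝ≥0∞ := ENNReal.ofReal (((T₀ + 2) ^ (2 - 2 * g)) ^ (3 / 2 : ℝ) * (T₀ + 2) ^ (-(3 * g))) *
    (c₀ : ℝ≥0∞) with hCD
  have hD2 : ∀ L : ℝ, 2 ≤ L → ∫⁻ y in ball (0 : EuclideanSpace ℝ (Fin 3)) L, ‖P y‖ₑ ^ (3 / 2 : ℝ) ≤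
      CD * ENNReal.ofReal (L ^ (2 - 2 * ρ)) :=
    fun L hL => lintegral_ball_avgPressure_le_nonpos (g := g) hcl hT₀ hg0 hD hL
  have h12 : (1 : ℝ) ≤ 2 := by norm_num
  have hE1 := Past.growth_ge_one_of_growth_ge h12 (by linarith : (0 : ℝ) ≤ 1 - ρ) hE2
  have hD1 := Past.growth_ge_one_of_growth_ge h12 (by linarith : (0 : ℝ) ≤ 2 - 2 * ρ) hD2
  set CE' : ℝ≥0∞ := CE * ENNReal.ofReal ((2 : ℝ) ^ (1 - ρ)) with hCE'
  set CD' : ℝ≥0∞ := CD * ENNReal.ofReal ((2 : ℝ) ^ (2 - 2 * ρ)) with hCD'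
  have hCE't : CE' ≠ ⊤ :=
    ENNReal.mul_ne_top (ENNReal.mul_ne_top ENNReal.ofReal_ne_top ENNReal.coe_ne_top) ENNReal.ofReal_ne_top
  have hCD't : CD' ≠ ⊤ :=
    ENNReal.mul_ne_top (ENNReal.mul_ne_top ENNReal.ofReal_ne_top ENNReal.coe_ne_top) ENNReal.ofReal_ne_top
  set κE : ℝ := (1 - ρ) / (2 + ρ) with hκE
  set κD : ℝ := (2 - 2 * ρ) / (2 + ρ) with hκD
  have hκE0 : 0 < κE := by rw [hκE]; exact div_pos (by linarith) h2ρ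
  have hκD0 : 0 < κD := by rw [hκD]; exact div_pos (by linarith) h2ρ
  set a : ℝ := CA.toReal with ha
  set e : ℝ := CE'.toReal with he
  set d : ℝ := CD'.toReal with hd
  have ha0 : 0 ≤ a := ENNReal.toReal_nonneg
  have he0 : 0 ≤ e := ENNReal.toReal_nonneg
  have hd0 : 0 ≤ d := ENNReal.toReal_nonneg
  set k₀ : ℝ := a + e / κE + d / κD with hk₀
  have hk₀0 : 0 ≤ k₀ := by positivity
  set c' : ℝ≥0 := k₀.toNNReal with hc'
  have hcc : (c' : ℝ≥0∞) = ENNReal.ofReal k₀ := rfl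
  have haC : CA = ENNReal.ofReal a := (ENNReal.ofReal_toReal hCAt).symm
  have heC : CE' = ENNReal.ofReal e := (ENNReal.ofReal_toReal hCE't).symm
  have hdC : CD' = ENNReal.ofReal d := (ENNReal.ofReal_toReal hCD't).symm
  have hAle : CA ≤ (c' : ℝ≥0∞) := by
    rw [haC, hcc]
    refine ENNReal.ofReal_le_ofReal ?_
    have : 0 ≤ e / κE + d / κD := by positivity
    rw [hk₀]; linarith
  have hEle : CE' ≤ ENNReal.ofReal κE * (c' : ℝ≥0∞) := by
    rw [heC, hcc, ← ENNReal.ofReal_mul hκE0.le]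
    refine ENNReal.ofReal_le_ofReal ?_
    have h1 : κE * (e / κE) = e := mul_div_cancel₀ e hκE0.ne'
    have h2 : 0 ≤ κE * a + κE * (d / κD) := by positivity
    rw [hk₀]; nlinarith [h1, h2]
  have hDle : CD' ≤ ENNReal.ofReal κD * (c' : ℝ≥0∞) := by
    rw [hdC, hcc, ← ENNReal.ofReal_mul hκD0.le]
    refine ENNReal.ofReal_le_ofReal ?_
    have h1 : κD * (d / κD) = d := mul_div_cancel₀ d hκD0.ne'
    have h2 : 0 ≤ κD * a + κD * (e / κE) := by positivity
    rw [hk₀]; nlinarith [h1, h2]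
  refine ⟨P, c', hPc.of_le (by exact_mod_cast le_top), heqP, fun L hL => (hA1 L hL).trans (mul_le_mul' hAle le_rfl),
    fun L hL => (hE1 L hL).trans ?_, fun L hL => (hD1 L hL).trans ?_⟩
  · rw [mul_comm]; exact mul_le_mul' le_rfl hEle
  · rw [mul_comm]; exact mul_le_mul' le_rfl hDle

/-- **CLASSICAL POWER CLOCKS WITH NEGATIVE RATE ABOUT ANY `T₀ ≥ 0` ARE TRIVIAL.**  Crux hypotheses (`0 < ρ ≤ ½`) + `(u, p)` classical
Euler on `(−∞, 0) × ℝ³` + `u(τ, y) = (T₀−τ)^{γ−1} W((T₀−τ)^{−γ} y)` for all `τ < 0` with `T₀ ≥ 0`, `γ < 0` ⇒ `u = 0` a.e. on `(−∞,0) × ℝ³`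
(scale-ODE rigidity with `κ = 2/γ − 5 < −5`). [folklore] -/
theorem ae_eq_zero_of_gauge_of_classicalNegPowerClock {ρ : ℝ} (hρ : 0 < ρ) (hρh : ρ ≤ 1 / 2) {c₀ : ℝ≥0}
    (hH : HasWeakSpatialGradientOn (slab (EuclideanSpace ℝ (Fin 3)) (Iio 0) isOpen_Iio) u H)
    (hgauge : ∀ a : ℝ, 0 < a →
      ENNReal.ofReal (a ^ (2 * ρ)) * cknA a (0 : ℝ × EuclideanSpace ℝ (Fin 3)) u +
          ENNReal.ofReal (a ^ ρ) * cknE a (0 : ℝ × EuclideanSpace ℝ (Fin 3)) H +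
        ENNReal.ofReal (a ^ (2 * ρ)) * cknD a (0 : ℝ × EuclideanSpace ℝ (Fin 3)) p ≤ (c₀ : ℝ≥0∞))
    (hcl : IsClassicalEulerSolutionOn (Iio 0) 0 u p) (hT₀ : 0 ≤ T₀) (hg : g < 0)
    (hW : ∀ τ : ℝ, τ < 0 → ∀ y, u τ y = (T₀ - τ) ^ (g - 1) • W ((T₀ - τ) ^ (-g) • y)) :
    uncurry u =ᵐ[volume.restrict (Iio (0 : ℝ) ×ˢ (univ : Set (EuclideanSpace ℝ (Fin 3))))] 0 := by
  have hρ1 : ρ < 1 := by linarith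
  obtain ⟨P, c', hP1, heq, hA, hE, hD⟩ := exists_locData_neg hρ hρh hH hgauge hcl hT₀ hg.le hW
  have hW1 : ContDiff ℝ 1 W := (PowerClock.contDiff_profile hcl hT₀ hW).of_le (by norm_num)
  have hdiv := PowerClock.isDivFree_profile hcl hT₀ hW
  have hgne : g ≠ 0 := hg.ne
  have hκβ : (2 / g - 5) * g = 2 * (1 - g) - 3 * g := by
    field_simp
    ring
  have hκ : (2 / g - 5) + 1 - 2 * ρ < 0 := by
    have h2 : 2 / g < 0 := div_neg_of_pos_of_neg two_pos hg
    linarith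
  have hW0 : W = 0 :=
    ClassicalProfile.eq_zero_of_locData_of_scaleODE hρ hρ1 hW1 hP1 hdiv hg.ne hκβ hκ heq hA hE hD
  filter_upwards [ae_restrict_mem (measurableSet_Iio.prod MeasurableSet.univ)] with q hq
  rw [mem_prod, mem_Iio] at hq
  show u q.1 q.2 = 0
  rw [hW q.1 hq.1 q.2, hW0, Pi.zero_apply, smul_zero]

end PowerClockRigidity

end Summit.NavierStokesRegularity.NavierStokesRegularity.Theorems.PowerGaugeEulerLiouville

end
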